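import Summits.QuantumFields.YangMills.Theorems.UnitScaleTiltProp7CombSymR12OfSiteRowT3
import Summits.QuantumFields.YangMills.Theorems.UnitScaleTiltProp7SymFrameMassOfRegPrT3
import Summits.QuantumFields.YangMills.Theorems.UnitScaleTiltProp7DbarTwSymWindow
import Summits.QuantumFields.YangMills.Theorems.UnitScaleTiltProp7ChartWindows
import Summits.QuantumFields.YangMills.Theorems.UnitScaleTiltProp7SPrintIn19Dict
import HarnessLib

/-!
# Route `UnitScaleTilt`, crux K1 «MinimiserStabilityRegPr» (stmt-QuantumFields-19200), route-R E′ (A′)-on-Σ, P-A2 row (β) of ★p1 g18's assembler ✓p698006 — file «(β)-ASSEMBLY G1»: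
# **THE ℓ¹ NORM OF THE COMB–SYM CHART-REMAINDER DIFFERENCE FROM FOUR MASSES** — the frame-ratio second-order row `R` (R0-RECURSION, px13), the comb inverse-frame mass `Pc`
# (F3″-COMB, routeR-w6; both ⟸ `hMcomb`, RULING №19), the symmetric frame mass (✓`Prop7SymFrameMassOfRegPr`, discharged here) and the top twisted-link mass (✓px17, discharged here):
# `Σ_ĉ ‖C^{tw}(iD)(ĉ) − C^{twS}(iD)(ĉ)‖ ≤ 6R + 408·Pc + 1632·Φˢ_top + 56·Z_top` at the Σ∕E2E datum

Cell `ym3-torus` (HUMAN RULING D-0037: YM₃ on the torus is ladder rung R3 — not d = 4, not a mass gap, not Clay), width seat `ym3-torus-px16` (gen 5); ★p1 g18 05:20:05Z «px16 is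
F3″-COMB's letter-consumer»; ★★OWNER RULING №19.  `--supports stmt-QuantumFields-19200 --as helper`; THEOREMS ONLY (0 `def`, 0 `sorry`); count-neutral.  Bookkeeping over landed doors;
the two displayed rows `hR0` (R0-RECURSION) and `hΦc` (F3″-COMB) are OPEN (both sit on the route-internal row `hMcomb`, XL); nothing of `hD`∕`hPA2`∕`hcoS`∕E′∕EX∕the crux is claimed.

THE PRINT.  [Balaban1985Averaging] (26)–(27) p. 22, (82) p. 30, (89)–(92) p. 31, (97) p. 32, Prop. 3 (122)–(126) p. 36; [Balaban1985Variational] (44) p. 285, Prop. 7 p. 299.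

WHY.  ✓p698233 `Prop7CombSymR12OfSiteRow.sum_norm_CmapTw_sub_CmapTwS_le_of_siteRow` bounds the difference by `6·Σ_y ρ y` plus the quadratic BCH term in the sup windows `p` (frame
ratio) and `z` (twisted top variable).  Taking `p, z` to be the norms themselves, the quadratic term is `≤ 204·Σ_y p(y)² + 56·Σ_c z(c)²` (each site is `c₋`∕`c₊` of three bonds); with
`g = w_c⁻¹·w_s`, `p ≤ ‖w_c⁻¹ − 1‖ + 2‖w_s − 1‖` so `Σ p² ≤ 2·Σ‖w_c⁻¹ − 1‖² + 8·Σ‖w_s − 1‖²`; `Σ_y‖w_s − 1‖²` is ✓`sum_normSq_frameTwS_sub_one_le_of_regPr` (F3″-Φˢ-EXPORT) and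
`Σ_c z²` is ✓px17 `sum_normSq_twistedLevelRatio_le_of_regPr` at `l = K − n` (`dbarTwS = V^{(K−n)}·Ū₀^{(K−n)⁻¹}` on the identified bonds, ✓`dbarTwS_eq_dbarCovIterU_mul_inv`).
What stays displayed: `R` and `Pc`, in their pens' letters.

WHAT IS PROVED (ns `…Theorems.Prop7CombSymDiffL1OfR0FrameMasses`; T³, `SU(2)`).
* §1 arithmetic∕algebra letters: `norm_inv_mul_sub_one_le`, `sq_le_of_le_add_two_mul`, `bch_quadratic_le`.
* §2 ★★ `sum_norm_CmapTw_sub_CmapTwS_le_of_masses` — GENERIC `A`: the four masses `R Pc Ps Pz` and three sup windows displayed; `≤ 6R + 408Pc + 1632Ps + 56Pz`.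
* §3 ★★★ `sum_norm_CmapTw_sub_CmapTwS_le_of_R0_combFrameMass` — AT THE Σ∕E2E DATUM (`RegPr F n K ε₀ W`, `D` Hermitian traceless, `‖D b‖ ≤ s`; windows `10¹⁴L⁹ε₀ ≤ 1`, `4s ≤ 1`,
  `4·10¹¹L⁹(ℓs) ≤ 1`, ✓px17's): sup windows, `A := I•D` reality, `Ps`, `Pz` DISCHARGED; displayed `hR0 : Σ_y‖mlog ↑g(y) − (r_s − r_c)(y)(I•D)‖ ≤ R` and `hΦc : Σ_y‖↑(frameTw W (I•D) y)⁻¹ − 1‖² ≤ Pc`;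
  conclusion `≤ 6R + 408Pc + 1632·⟨Φˢ_top bound⟩ + 56·⟨Z_top bound⟩` in px17's `M₀ = Σ‖pertVar W (e^{iD}W)‖²` ∕ `KD = CURL + DIV` letters.
HONEST SCOPE.  No estimate of print asserted beyond the cited rows; constants crude; the X-letter cut to ✓p698006's `hD` (via ★routeR-w4 ✓p695503) is a separate file (G2).

References: T. Bałaban, CMP **98** (1985) 17–51 [Balaban1985Averaging] ((5) p.18, (26)–(27) p.22, (82) p.30, (89)–(92) p.31, (97) p.32, Prop. 3 (122)–(126) p.36, Prop. 4 (134)–(135) p.38);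
CMP **102** (1985) 277–309 [Balaban1985Variational] ((14)–(15) p.280, (19) p.281, (44)–(48) p.285, Prop. 7 p.299); CMP **95** (1984) 17–40 [Balaban1984PropagatorsI] ((1.18)–(1.20) pp.19–20).
-/

set_option autoImplicit false

noncomputable section

open scoped BigOperators Matrix.Norms.L2Operator Matrix

namespace Summit.QuantumFields.YangMills.Theorems.Prop7CombSymDiffL1OfR0FrameMasses

open Finset
open Literature.MathematicalPhysics.QuantumFieldTheory.Balaban1983to89
open Literature.MathematicalPhysics.QuantumFieldTheory.Balaban1983to89.T3ContinuumYM3Torus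
open MatrixLog (mlog)
open T3SectALandauChart (bgUnits emb15 eta eta_pos)
open T3PrintedRegularMinimiser (RegPr)
open T4Continuum BlockAveraging AveragingRT ExpMeanLog BlockAveragingEMLLinearised BlockAveragingEMLLinearisedBackground
open B9Eq39Adjoint (curl divB)
open B10Eq27TorusAxialLog (unitsField toUField)
open B9TorusCalculus (torusT)
open B7Prop1Explicit (expUnit)
open T3LevelShift (siteShift bondShift)
open T3PrintedRegularOrbits (sites_eq)
open Summit.QuantumFields.YangMills.Theorems.Prop7TPrint (expHermField)
open Summit.QuantumFields.YangMills.Theorems.Prop8Chart (emlIterU)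
open Summit.QuantumFields.YangMills.Theorems.Prop7SymAvgTw (frameTw QTw CmapTw)
open Summit.QuantumFields.YangMills.Theorems.Prop7SymAvgTwSym (frameTwS dbarTwS QTwS CmapTwS dbarCovIterU dbarTwS_eq_dbarCovIterU_mul_inv)
open Summit.QuantumFields.YangMills.Theorems.Prop7CombSymR12OfSiteRow (sum_norm_CmapTw_sub_CmapTwS_le_of_siteRow)
open Summit.QuantumFields.YangMills.Theorems.Prop7GaugeTwistLogRatio (sum_pbond_src sum_pbond_tgt)
open Summit.QuantumFields.YangMills.Theorems.Prop7SymFrameMassOfRegPr (sum_normSq_frameTwS_sub_one_le_of_regPr)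
open Summit.QuantumFields.YangMills.Theorems.Prop7TwistedLevelMassOfRegPr (sum_normSq_twistedLevelRatio_le_of_regPr)
open Summit.QuantumFields.YangMills.Theorems.Prop7DbarTwSymWindow (norm_dbarTwS_sub_one_le)
open Summit.QuantumFields.YangMills.Theorems.Prop7DbarTwWindow (norm_frameTw_sub_one_le_of_regPr)
open Summit.QuantumFields.YangMills.Theorems.Prop7ChartWindows (windowsS_of_small)
open Summit.QuantumFields.YangMills.Theorems.Prop7Chart48SymUntwisted (unitsField_toUField_emb15_expHermField)
open Summit.QuantumFields.YangMills.Theorems.Prop7SPrintIn19 (pow_mul_eta)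

/-! ## §1 Letters -/

section Letters

/-- `‖u⁻¹·v − 1‖ ≤ a + 2b` for units with `‖u⁻¹ − 1‖ ≤ a ≤ 1`, `‖v − 1‖ ≤ b` (`u⁻¹v − 1 = (u⁻¹ − 1)(v − 1) + (u⁻¹ − 1) + (v − 1)`). [cite: Balaban1985Averaging, (27) p.22] -/
theorem norm_inv_mul_sub_one_le {u v : (Matrix (Fin 2) (Fin 2) ℂ)ˣ} {a b : ℝ}
    (ha : ‖(((u⁻¹ : (Matrix (Fin 2) (Fin 2) ℂ)ˣ)) : Matrix (Fin 2) (Fin 2) ℂ) - 1‖ ≤ a) (ha1 : a ≤ 1)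
    (hb : ‖((v : (Matrix (Fin 2) (Fin 2) ℂ)ˣ) : Matrix (Fin 2) (Fin 2) ℂ) - 1‖ ≤ b) :
    ‖((u⁻¹ * v : (Matrix (Fin 2) (Fin 2) ℂ)ˣ) : Matrix (Fin 2) (Fin 2) ℂ) - 1‖ ≤ a + 2 * b := by
  have hb0 : 0 ≤ b := (norm_nonneg _).trans hb
  have e1 : ((u⁻¹ * v : (Matrix (Fin 2) (Fin 2) ℂ)ˣ) : Matrix (Fin 2) (Fin 2) ℂ) - 1
      = ((((u⁻¹ : (Matrix (Fin 2) (Fin 2) ℂ)ˣ)) : Matrix (Fin 2) (Fin 2) ℂ) - 1) * (((v : (Matrix (Fin 2) (Fin 2) ℂ)ˣ) : Matrix (Fin 2) (Fin 2) ℂ) - 1)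
        + ((((u⁻¹ : (Matrix (Fin 2) (Fin 2) ℂ)ˣ)) : Matrix (Fin 2) (Fin 2) ℂ) - 1) + (((v : (Matrix (Fin 2) (Fin 2) ℂ)ˣ) : Matrix (Fin 2) (Fin 2) ℂ) - 1) := by
    rw [Units.val_mul]; noncomm_ring
  rw [e1]
  have h1 : ‖((((u⁻¹ : (Matrix (Fin 2) (Fin 2) ℂ)ˣ)) : Matrix (Fin 2) (Fin 2) ℂ) - 1) * (((v : (Matrix (Fin 2) (Fin 2) ℂ)ˣ) : Matrix (Fin 2) (Fin 2) ℂ) - 1)‖ ≤ a * b :=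
    (norm_mul_le _ _).trans (mul_le_mul ha hb (norm_nonneg _) ((norm_nonneg _).trans ha))
  have hab : a * b ≤ b := by nlinarith
  calc _ ≤ ‖((((u⁻¹ : (Matrix (Fin 2) (Fin 2) ℂ)ˣ)) : Matrix (Fin 2) (Fin 2) ℂ) - 1) * (((v : (Matrix (Fin 2) (Fin 2) ℂ)ˣ) : Matrix (Fin 2) (Fin 2) ℂ) - 1)
            + ((((u⁻¹ : (Matrix (Fin 2) (Fin 2) ℂ)ˣ)) : Matrix (Fin 2) (Fin 2) ℂ) - 1)‖ + ‖((v : (Matrix (Fin 2) (Fin 2) ℂ)ˣ) : Matrix (Fin 2) (Fin 2) ℂ) - 1‖ := norm_add_le _ _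
    _ ≤ (a * b + a) + b := add_le_add ((norm_add_le _ _).trans (add_le_add h1 ha)) hb
    _ ≤ a + 2 * b := by linarith

/-- `(a + 2b)² ≤ 2a² + 8b²`. [folklore] -/
theorem sq_le_of_le_add_two_mul {p a b : ℝ} (hp0 : 0 ≤ p) (hp : p ≤ a + 2 * b) : p ^ 2 ≤ 2 * a ^ 2 + 8 * b ^ 2 := by
  nlinarith [sq_nonneg (a - 2 * b)]

/-- the BCH quadratic of the R12 door, pointwise: for `0 ≤ p₋, p₊, z ≤ 1`, `4(p₋ + z)² + 4(p₋ + z + p₋z + 2p₊)² ≤ 20p₋² + 48p₊² + 56z²`. [folklore] -/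
theorem bch_quadratic_le {a c z : ℝ} (ha0 : 0 ≤ a) (ha1 : a ≤ 1) (hc0 : 0 ≤ c) (hz0 : 0 ≤ z) :
    4 * (a + z) ^ 2 + 4 * (a + z + a * z + 2 * c) ^ 2 ≤ 20 * a ^ 2 + 48 * c ^ 2 + 56 * z ^ 2 := by
  have haz : a * z ≤ z := by nlinarith
  have h1 : (a + z + a * z + 2 * c) ^ 2 ≤ (a + 2 * z + 2 * c) ^ 2 := by
    have hl : 0 ≤ a + z + a * z + 2 * c := by positivity
    nlinarith
  nlinarith [sq_nonneg (a - z), sq_nonneg (a - 2 * z), sq_nonneg (a - 2 * c), sq_nonneg (2 * z - 2 * c), sq_nonneg (z - c)]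

end Letters

/-! ## §2 ★★ The generic door: four masses and three sup windows displayed -/

section Generic

variable (F : T3Family) {n K : ℕ} (h : n ≤ K)

/-- ★★ **`Σ_c ‖C^{tw}(A) − C^{twS}(A)‖ ≤ 6R + 408Pc + 1632Ps + 56Pz`** at `RegPr F n K ε₀ W` (`10¹⁰L⁶ε₀ ≤ 1`, `10¹²L³ε₀ ≤ 1`), for bondwise skew-adjoint traceless `A`, with the sup windows
`‖w_c(y)⁻¹ − 1‖ ≤ 1∕200`, `‖w_s(y) − 1‖ ≤ 1∕400`, `‖U̿^{twS}(c) − 1‖ ≤ 1∕30` and the four masses DISPLAYED: `R` (the (R0) row summed), `Pc = Σ‖w_c⁻¹ − 1‖²`, `Ps = Σ‖w_s − 1‖²`, `Pz = Σ‖U̿^{twS} − 1‖²`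
(✓R12 door at `ρ := ` the (R0) quantity, `p z :=` the norms; §1). [cite: Balaban1985Averaging, (26)-(27) p.22, (89)-(92) p.31, (5) p.18; Balaban1985Variational, (44)-(48) p.285] -/
theorem sum_norm_CmapTw_sub_CmapTwS_le_of_masses {ε₀ : ℝ} (hε₀ : 0 < ε₀) (hε : 10 ^ 10 * (F.L : ℝ) ^ 6 * ε₀ ≤ 1) (hε12 : 10 ^ 12 * (F.L : ℝ) ^ 3 * ε₀ ≤ 1)
    (W : GaugeField (F.P K) 0 (Matrix.specialUnitaryGroup (Fin 2) ℂ)) (hreg : RegPr F n K ε₀ W)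
    (A : PBond (F.P K) 0 → Matrix (Fin 2) (Fin 2) ℂ) (hA : ∀ b, A b ∈ skewAdjoint (Matrix (Fin 2) (Fin 2) ℂ)) (htr : ∀ b, (A b).trace = 0)
    (hwc : ∀ y : Site (F.P n) 0, ‖(((frameTw F n K h W A y)⁻¹ : (Matrix (Fin 2) (Fin 2) ℂ)ˣ) : Matrix (Fin 2) (Fin 2) ℂ) - 1‖ ≤ 1 / 200)
    (hws : ∀ y : Site (F.P n) 0, ‖((frameTwS F n K h W A y : (Matrix (Fin 2) (Fin 2) ℂ)ˣ) : Matrix (Fin 2) (Fin 2) ℂ) - 1‖ ≤ 1 / 400)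
    (hzs : ∀ c : PBond (F.P n) 0, ‖((dbarTwS F n K h W A c : (Matrix (Fin 2) (Fin 2) ℂ)ˣ) : Matrix (Fin 2) (Fin 2) ℂ) - 1‖ ≤ 1 / 30)
    {R Pc Ps Pz : ℝ}
    (hR0 : ∑ y : Site (F.P n) 0, ‖mlog ((((frameTw F n K h W A y)⁻¹ * frameTwS F n K h W A y : (Matrix (Fin 2) (Fin 2) ℂ)ˣ) : Matrix (Fin 2) (Fin 2) ℂ))
          - (fderiv ℂ (fun A : PBond (F.P K) 0 → Matrix (Fin 2) (Fin 2) ℂ => ((frameTwS F n K h W A y : (Matrix (Fin 2) (Fin 2) ℂ)ˣ) : Matrix (Fin 2) (Fin 2) ℂ)) 0 A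
              - fderiv ℂ (fun A : PBond (F.P K) 0 → Matrix (Fin 2) (Fin 2) ℂ => ((frameTw F n K h W A y : (Matrix (Fin 2) (Fin 2) ℂ)ˣ) : Matrix (Fin 2) (Fin 2) ℂ)) 0 A)‖ ≤ R)
    (hΦc : ∑ y : Site (F.P n) 0, ‖(((frameTw F n K h W A y)⁻¹ : (Matrix (Fin 2) (Fin 2) ℂ)ˣ) : Matrix (Fin 2) (Fin 2) ℂ) - 1‖ ^ 2 ≤ Pc)
    (hΦs : ∑ y : Site (F.P n) 0, ‖((frameTwS F n K h W A y : (Matrix (Fin 2) (Fin 2) ℂ)ˣ) : Matrix (Fin 2) (Fin 2) ℂ) - 1‖ ^ 2 ≤ Ps)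
    (hZ : ∑ c : PBond (F.P n) 0, ‖((dbarTwS F n K h W A c : (Matrix (Fin 2) (Fin 2) ℂ)ˣ) : Matrix (Fin 2) (Fin 2) ℂ) - 1‖ ^ 2 ≤ Pz) :
    ∑ c : PBond (F.P n) 0, ‖CmapTw F n K h W A c - CmapTwS F n K h W A c‖ ≤ 6 * R + 408 * Pc + 1632 * Ps + 56 * Pz := by
  have hd : ((F.P n).d : ℝ) = 3 := by exact_mod_cast T3Family.P_d F n
  -- the sup letters `p`, `z` are the norms themselves
  set p : Site (F.P n) 0 → ℝ := fun y => ‖(((frameTw F n K h W A y)⁻¹ * frameTwS F n K h W A y : (Matrix (Fin 2) (Fin 2) ℂ)ˣ) : Matrix (Fin 2) (Fin 2) ℂ) - 1‖ with hp_def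
  set z : PBond (F.P n) 0 → ℝ := fun c => ‖((dbarTwS F n K h W A c : (Matrix (Fin 2) (Fin 2) ℂ)ˣ) : Matrix (Fin 2) (Fin 2) ℂ) - 1‖ with hz_def
  have hp0 : ∀ y, 0 ≤ p y := fun y => norm_nonneg _
  have hz0 : ∀ c, 0 ≤ z c := fun c => norm_nonneg _
  have hple : ∀ y, p y ≤ 1 / 200 + 2 * ‖((frameTwS F n K h W A y : (Matrix (Fin 2) (Fin 2) ℂ)ˣ) : Matrix (Fin 2) (Fin 2) ℂ) - 1‖ :=
    fun y => norm_inv_mul_sub_one_le (hwc y) (by norm_num) le_rfl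
  have hp' : ∀ y, p y ≤ 1 / 60 := fun y => by have := hple y; have := hws y; linarith
  have hp1 : ∀ y, p y ≤ 1 := fun y => (hp' y).trans (by norm_num)
  have hz' : ∀ c, z c ≤ 1 / 30 := hzs
  -- the R12 door at `ρ :=` the (R0) quantity
  have hdoor := sum_norm_CmapTw_sub_CmapTwS_le_of_siteRow F h hε₀ hε hε12 W hreg A hA htr p z (fun y => le_rfl) (fun c => le_rfl) hp' hz'
    (fun y => ‖mlog ((((frameTw F n K h W A y)⁻¹ * frameTwS F n K h W A y : (Matrix (Fin 2) (Fin 2) ℂ)ˣ) : Matrix (Fin 2) (Fin 2) ℂ))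
          - (fderiv ℂ (fun A : PBond (F.P K) 0 → Matrix (Fin 2) (Fin 2) ℂ => ((frameTwS F n K h W A y : (Matrix (Fin 2) (Fin 2) ℂ)ˣ) : Matrix (Fin 2) (Fin 2) ℂ)) 0 A
              - fderiv ℂ (fun A : PBond (F.P K) 0 → Matrix (Fin 2) (Fin 2) ℂ => ((frameTw F n K h W A y : (Matrix (Fin 2) (Fin 2) ℂ)ˣ) : Matrix (Fin 2) (Fin 2) ℂ)) 0 A)‖)
    (fun y => le_rfl)
  -- the quadratic term, pointwise and summed
  have hquad : ∑ c : PBond (F.P n) 0, (4 * (p c.src + z c) ^ 2 + 4 * (p c.src + z c + p c.src * z c + 2 * p c.tgt) ^ 2)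
      ≤ ∑ c : PBond (F.P n) 0, (20 * p c.src ^ 2 + 48 * p c.tgt ^ 2 + 56 * z c ^ 2) :=
    Finset.sum_le_sum fun c _ => bch_quadratic_le (hp0 c.src) (hp1 c.src) (hp0 c.tgt) (hz0 c)
  have hsplit : ∑ c : PBond (F.P n) 0, (20 * p c.src ^ 2 + 48 * p c.tgt ^ 2 + 56 * z c ^ 2)
      = 20 * (3 * ∑ y : Site (F.P n) 0, p y ^ 2) + 48 * (3 * ∑ y : Site (F.P n) 0, p y ^ 2) + 56 * ∑ c : PBond (F.P n) 0, z c ^ 2 := by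
    rw [Finset.sum_add_distrib, Finset.sum_add_distrib, ← Finset.mul_sum, ← Finset.mul_sum, ← Finset.mul_sum,
      sum_pbond_src (fun y => p y ^ 2), sum_pbond_tgt (fun y => p y ^ 2), hd]
  -- `Σ p² ≤ 2Pc + 8Ps`
  have hpsq : ∑ y : Site (F.P n) 0, p y ^ 2 ≤ 2 * Pc + 8 * Ps := by
    calc ∑ y : Site (F.P n) 0, p y ^ 2
        ≤ ∑ y : Site (F.P n) 0, (2 * ‖(((frameTw F n K h W A y)⁻¹ : (Matrix (Fin 2) (Fin 2) ℂ)ˣ) : Matrix (Fin 2) (Fin 2) ℂ) - 1‖ ^ 2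
            + 8 * ‖((frameTwS F n K h W A y : (Matrix (Fin 2) (Fin 2) ℂ)ˣ) : Matrix (Fin 2) (Fin 2) ℂ) - 1‖ ^ 2) :=
          Finset.sum_le_sum fun y _ => sq_le_of_le_add_two_mul (hp0 y)
            (norm_inv_mul_sub_one_le le_rfl ((hwc y).trans (by norm_num)) le_rfl)
      _ = 2 * ∑ y : Site (F.P n) 0, ‖(((frameTw F n K h W A y)⁻¹ : (Matrix (Fin 2) (Fin 2) ℂ)ˣ) : Matrix (Fin 2) (Fin 2) ℂ) - 1‖ ^ 2
            + 8 * ∑ y : Site (F.P n) 0, ‖((frameTwS F n K h W A y : (Matrix (Fin 2) (Fin 2) ℂ)ˣ) : Matrix (Fin 2) (Fin 2) ℂ) - 1‖ ^ 2 := by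
          rw [Finset.sum_add_distrib, ← Finset.mul_sum, ← Finset.mul_sum]
      _ ≤ 2 * Pc + 8 * Ps := by linarith
  have hzsq : ∑ c : PBond (F.P n) 0, z c ^ 2 ≤ Pz := hZ
  have hPc0 : 0 ≤ Pc := le_trans (Finset.sum_nonneg fun _ _ => sq_nonneg _) hΦc
  have hPs0 : 0 ≤ Ps := le_trans (Finset.sum_nonneg fun _ _ => sq_nonneg _) hΦs
  linarith [hdoor, hquad, hsplit, hpsq, hzsq]

end Generic

/-! ## §3 ★★★ At the Σ∕E2E datum: the symmetric frame mass, the top twisted-link mass and the sup windows discharged -/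

section Member

variable (F : T3Family) (n K : ℕ)

/-- ★★★ **THE (β) DIFFERENCE ROW FROM THE TWO `hMcomb`-ROWS** (★p1 g18 assembler ✓p698006 row `hD`, pertVar currency): at `RegPr F n K ε₀ W`, `D` Hermitian traceless with `‖D b‖ ≤ s`,
windows `10¹⁴L⁹ε₀ ≤ 1`, `4s ≤ 1`, `4·10¹¹L⁹(ℓs) ≤ 1`, and the two DISPLAYED rows — (R0) summed, `hR0 : Σ_y‖mlog ↑g(y) − (r_s − r_c)(y)(I•D)‖ ≤ R` (R0-RECURSION, px13), and the comb inverse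
accumulated-frame mass `hΦc : Σ_y‖↑(frameTw W (I•D) y)⁻¹ − 1‖² ≤ Pc` (F3″-COMB, routeR-w6; both ⟸ `hMcomb`, route-internal, OPEN, XL — RULING №19) —
`Σ_ĉ ‖CmapTw W (I•D) ĉ − CmapTwS W (I•D) ĉ‖ ≤ 6R + 408·Pc + 1632·Φˢ_top + 56·Z_top` with `Φˢ_top` = ✓`sum_normSq_frameTwS_sub_one_le_of_regPr`'s and `Z_top` = ✓px17
`sum_normSq_twistedLevelRatio_le_of_regPr`'s (`l = K − n`) right sides in `M₀`∕`KD` letters, written out.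
[cite: Balaban1985Averaging, (26)-(27) p.22, (82) p.30, (89)-(92) p.31, (97) p.32, Prop. 3 (122)-(126) p.36; Balaban1985Variational, (14)-(15) p.280, (44)-(48) p.285, Prop. 7 p.299] -/
theorem sum_norm_CmapTw_sub_CmapTwS_le_of_R0_combFrameMass (h : n ≤ K) {ε₀ s : ℝ} (hε₀ : 0 < ε₀) (hεL : 100000000000000 * (F.L : ℝ) ^ 9 * ε₀ ≤ 1)
    (hs0 : 0 ≤ s) (hs4 : 4 * s ≤ 1) (hsL : 400000000000 * (F.L : ℝ) ^ 9 * (((F.L : ℝ) ^ (K - n)) * s) ≤ 1)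
    {W : GaugeField (F.P K) 0 (Matrix.specialUnitaryGroup (Fin 2) ℂ)} (hreg : RegPr F n K ε₀ W)
    (D : PBond (F.P K) 0 → Matrix (Fin 2) (Fin 2) ℂ) (hD : ∀ b : PBond (F.P K) 0, (D b).IsHermitian ∧ Matrix.trace (D b) = 0)
    (hs : ∀ b : PBond (F.P K) 0, ‖D b‖ ≤ s)
    {R Pc : ℝ}
    (hR0 : ∑ y : Site (F.P n) 0, ‖mlog ((((frameTw F n K h W (fun b => Complex.I • D b) y)⁻¹ * frameTwS F n K h W (fun b => Complex.I • D b) y : (Matrix (Fin 2) (Fin 2) ℂ)ˣ) : Matrix (Fin 2) (Fin 2) ℂ))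
          - (fderiv ℂ (fun A : PBond (F.P K) 0 → Matrix (Fin 2) (Fin 2) ℂ => ((frameTwS F n K h W A y : (Matrix (Fin 2) (Fin 2) ℂ)ˣ) : Matrix (Fin 2) (Fin 2) ℂ)) 0 (fun b => Complex.I • D b)
              - fderiv ℂ (fun A : PBond (F.P K) 0 → Matrix (Fin 2) (Fin 2) ℂ => ((frameTw F n K h W A y : (Matrix (Fin 2) (Fin 2) ℂ)ˣ) : Matrix (Fin 2) (Fin 2) ℂ)) 0 (fun b => Complex.I • D b))‖ ≤ R)
    (hΦc : ∑ y : Site (F.P n) 0, ‖(((frameTw F n K h W (fun b => Complex.I • D b) y)⁻¹ : (Matrix (Fin 2) (Fin 2) ℂ)ˣ) : Matrix (Fin 2) (Fin 2) ℂ) - 1‖ ^ 2 ≤ Pc) :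
    ∑ c : PBond (F.P n) 0, ‖CmapTw F n K h W (fun b => Complex.I • D b) c - CmapTwS F n K h W (fun b => Complex.I • D b) c‖
      ≤ 6 * R + 408 * Pc
        + 1632 * (2 * (F.L : ℝ) * (40 * (F.L : ℝ) ^ 2) * (7 * (∑ b : PBond (F.P K) 0, ‖pertVar W (emb15 W (expHermField D)) b‖ ^ 2) * ((F.L : ℝ) ^ (K - n))⁻¹)
          + 40 * (F.L : ℝ) ^ 2 * ((28800 * (F.L : ℝ) ^ 4 * ((∑ x : Site (F.P K) 0, ∑ μ : Fin (F.P K).d, ∑ ν : Fin (F.P K).d,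
            (if μ < ν then ∑ j : Fin 2, ∑ k : Fin 2,
              ‖(curl (torusT (F.P K) 0) (fun κ z => unitsField (toUField W) ⟨z, κ⟩) (fun κ z => pertVar W (emb15 W (expHermField D)) ⟨z, κ⟩) μ ν x) j k‖ ^ 2 else 0)) + (∑ x : Site (F.P K) 0, ∑ j : Fin 2, ∑ k : Fin 2,
            ‖(divB (torusT (F.P K) 0) (fun κ z => unitsField (toUField W) ⟨z, κ⟩) (fun κ z => pertVar W (emb15 W (expHermField D)) ⟨z, κ⟩) x) j k‖ ^ 2))
            + 600000 * (F.L : ℝ) ^ 4 * (((F.L : ℝ) ^ (K - n)) ^ 2)⁻¹ * (∑ b : PBond (F.P K) 0, ‖pertVar W (emb15 W (expHermField D)) b‖ ^ 2)) * (F.L : ℝ) ^ (K - n)))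
        + 56 * ((21 + 10080 * (F.L : ℝ) ^ 3) * ((∑ b : PBond (F.P K) 0, ‖pertVar W (emb15 W (expHermField D)) b‖ ^ 2) * ((F.L : ℝ) ^ (K - n))⁻¹)
          + (3 + 720 * (F.L : ℝ) ^ 2) * ((28800 * (F.L : ℝ) ^ 4 * ((∑ x : Site (F.P K) 0, ∑ μ : Fin (F.P K).d, ∑ ν : Fin (F.P K).d,
            (if μ < ν then ∑ j : Fin 2, ∑ k : Fin 2,
              ‖(curl (torusT (F.P K) 0) (fun κ z => unitsField (toUField W) ⟨z, κ⟩) (fun κ z => pertVar W (emb15 W (expHermField D)) ⟨z, κ⟩) μ ν x) j k‖ ^ 2 else 0)) + (∑ x : Site (F.P K) 0, ∑ j : Fin 2, ∑ k : Fin 2,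
            ‖(divB (torusT (F.P K) 0) (fun κ z => unitsField (toUField W) ⟨z, κ⟩) (fun κ z => pertVar W (emb15 W (expHermField D)) ⟨z, κ⟩) x) j k‖ ^ 2))
            + 600000 * (F.L : ℝ) ^ 4 * (((F.L : ℝ) ^ (K - n)) ^ 2)⁻¹ * (∑ b : PBond (F.P K) 0, ‖pertVar W (emb15 W (expHermField D)) b‖ ^ 2)) * (F.L : ℝ) ^ (K - n))) := by
  -- letters and windows
  have hL3 : (3 : ℝ) ≤ F.L := Prop7CurvedLandauKnitT3.three_le_L F
  have hL0 : (0 : ℝ) < F.L := by linarith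
  have hL1 : (1 : ℝ) ≤ F.L := by linarith
  have hPL : ((F.P K).L : ℝ) = F.L := rfl
  set ℓ : ℝ := (F.L : ℝ) ^ (K - n) with hℓ
  have hℓ1 : 1 ≤ ℓ := one_le_pow₀ hL1
  have hℓ0 : 0 < ℓ := by positivity
  have hη : ℓ * eta F n K = 1 := by rw [hℓ, ← hPL]; exact pow_mul_eta F n K
  -- the sup radius `e := ℓ·s` of `A = I•D`: `‖A b‖ ≤ e·η = s`
  set e : ℝ := ℓ * s with he_def
  have he0 : 0 ≤ e := by positivity
  have heη : e * eta F n K = s := by rw [he_def, mul_assoc, mul_comm s, ← mul_assoc, hη, one_mul]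
  have hA : ∀ b, ‖(fun b => Complex.I • D b) b‖ ≤ e * eta F n K := fun b => by
    show ‖Complex.I • D b‖ ≤ e * eta F n K
    rw [heη, norm_smul, Complex.norm_I, one_mul]; exact hs b
  -- numeric windows (all from `10¹⁴L⁹ε₀ ≤ 1`, `4·10¹¹L⁹e ≤ 1`, `L ≥ 3`)
  have hL2 : (F.L : ℝ) ≤ (F.L : ℝ) ^ 2 := le_self_pow₀ hL1 two_ne_zero
  have hL23 : (F.L : ℝ) ^ 2 ≤ (F.L : ℝ) ^ 3 := pow_le_pow_right₀ hL1 (by norm_num)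
  have hL9 : (F.L : ℝ) ^ 2 ≤ (F.L : ℝ) ^ 9 := pow_le_pow_right₀ hL1 (by norm_num)
  have hL39 : (F.L : ℝ) ^ 3 ≤ (F.L : ℝ) ^ 9 := pow_le_pow_right₀ hL1 (by norm_num)
  have hL69 : (F.L : ℝ) ^ 6 ≤ (F.L : ℝ) ^ 9 := pow_le_pow_right₀ hL1 (by norm_num)
  have hL2pos : (0 : ℝ) ≤ (F.L : ℝ) ^ 2 := by positivity
  have k1 : (F.L : ℝ) ^ 2 * e ≤ (F.L : ℝ) ^ 9 * e := mul_le_mul_of_nonneg_right hL9 he0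
  have k2 : (F.L : ℝ) ^ 2 * ε₀ ≤ (F.L : ℝ) ^ 9 * ε₀ := mul_le_mul_of_nonneg_right hL9 hε₀.le
  have k3 : (F.L : ℝ) ^ 3 * ε₀ ≤ (F.L : ℝ) ^ 9 * ε₀ := mul_le_mul_of_nonneg_right hL39 hε₀.le
  have k6 : (F.L : ℝ) ^ 6 * ε₀ ≤ (F.L : ℝ) ^ 9 * ε₀ := mul_le_mul_of_nonneg_right hL69 hε₀.le
  have k4 : (F.L : ℝ) * e ≤ (F.L : ℝ) ^ 2 * e := mul_le_mul_of_nonneg_right hL2 he0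
  have k5 : (F.L : ℝ) ^ 2 * ε₀ ≤ (F.L : ℝ) ^ 3 * ε₀ := mul_le_mul_of_nonneg_right hL23 hε₀.le
  have he9 : 10 ^ 9 * (F.L : ℝ) ^ 2 * e ≤ 1 := by linarith only [k1, hsL]
  have hε12 : 10 ^ 12 * (F.L : ℝ) ^ 3 * ε₀ ≤ 1 := by linarith only [k3, hεL]
  have hε10 : 10 ^ 10 * (F.L : ℝ) ^ 6 * ε₀ ≤ 1 := by linarith only [k6, hεL]
  have hε9 : ε₀ * ((F.P K).L : ℝ) ^ 2 ≤ 1 / 10 ^ 9 := by rw [hPL]; linarith only [k2, hεL]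
  have he9' : e * ((F.P K).L : ℝ) ^ 2 ≤ 1 / 10 ^ 9 := by rw [hPL]; linarith only [k1, hsL]
  have hLe : (F.L : ℝ) * e ≤ 1 / 10 ^ 9 := by linarith only [k4, k1, hsL]
  have hL2ε : (F.L : ℝ) ^ 2 * ε₀ ≤ 1 / 10 ^ 12 := by linarith only [k5, k3, hεL]
  -- `A = I•D` is skew-adjoint traceless
  have hAskew : ∀ b, (fun b => Complex.I • D b) b ∈ skewAdjoint (Matrix (Fin 2) (Fin 2) ℂ) := fun b => by
    have hH := (hD b).1
    refine skewAdjoint.mem_iff.2 ?_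
    show star (Complex.I • D b) = -(Complex.I • D b)
    rw [star_smul, Complex.star_def, Complex.conj_I, Matrix.star_eq_conjTranspose, hH.eq, neg_smul]
  have hAtr : ∀ b, ((fun b => Complex.I • D b) b).trace = 0 := fun b => by
    show (Complex.I • D b).trace = 0
    rw [Matrix.trace_smul, (hD b).2, smul_zero]
  -- the fixed positive radius `e₁ := (10⁹L²)⁻¹ ≥ e` for the comb frame window (lit (163) is stated for `0 < e`)
  set e₁ : ℝ := (10 ^ 9 * (F.L : ℝ) ^ 2)⁻¹ with he₁
  have hX0 : (0 : ℝ) < 10 ^ 9 * (F.L : ℝ) ^ 2 := by positivity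
  have he₁0 : 0 < e₁ := by rw [he₁]; positivity
  have he₁X : e₁ * (10 ^ 9 * (F.L : ℝ) ^ 2) = 1 := by rw [he₁, inv_mul_cancel₀ hX0.ne']
  have hee₁ : e ≤ e₁ := by
    refine le_of_mul_le_mul_right ?_ hX0
    rw [he₁X]; linarith only [he9]
  have he₁9 : e₁ * ((F.P K).L : ℝ) ^ 2 ≤ 1 / 10 ^ 9 := by
    rw [hPL]
    have : e₁ * (F.L : ℝ) ^ 2 = (e₁ * (10 ^ 9 * (F.L : ℝ) ^ 2)) / 10 ^ 9 := by ring
    rw [this, he₁X]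
  have hA1 : ∀ b, ‖(fun b => Complex.I • D b) b‖ ≤ e₁ * eta F n K :=
    fun b => (hA b).trans (mul_le_mul_of_nonneg_right hee₁ (eta_pos F n K).le)
  obtain ⟨hα3, hα4, -, -, hsmall, hc₃, hsm, -, -⟩ := windowsS_of_small F K hε₀ he₁0 hε9 he₁9
  -- sup windows
  have hwc : ∀ y : Site (F.P n) 0, ‖(((frameTw F n K h W (fun b => Complex.I • D b) y)⁻¹ : (Matrix (Fin 2) (Fin 2) ℂ)ˣ) : Matrix (Fin 2) (Fin 2) ℂ) - 1‖ ≤ 1 / 200 := by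
    intro y
    have h192 := (norm_frameTw_sub_one_le_of_regPr F h hε₀ he₁0.le hα3 hα4 hsmall hc₃ hsm W hreg (fun b => Complex.I • D b) hA1 y).2
    have h9 : (3 : ℝ) ^ 2 ≤ (F.L : ℝ) ^ 2 := pow_le_pow_left₀ (by norm_num) hL3 2
    have he₁s : e₁ ≤ 1 / (10 ^ 9 * 9) := by
      rw [he₁, one_div]; exact inv_anti₀ (by norm_num) (by linarith only [h9])
    exact h192.trans (by linarith only [he₁s])
  have d0 : Fin (F.P n).d := ⟨0, by rw [T3Family.P_d]; norm_num⟩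
  have hsym := fun c : PBond (F.P n) 0 => norm_dbarTwS_sub_one_le F h hε₀ he0 he9 hε12 W hreg (fun b => Complex.I • D b) hA c
  have heS : e ≤ 1 / 10 ^ 9 := by
    have : e ≤ (F.L : ℝ) * e := le_mul_of_one_le_left he0 hL1
    linarith only [this, hLe]
  have hLε : (F.L : ℝ) * ε₀ ≤ 1 / 10 ^ 12 := by
    have : (F.L : ℝ) * ε₀ ≤ (F.L : ℝ) ^ 2 * ε₀ := mul_le_mul_of_nonneg_right hL2 hε₀.le
    linarith only [this, hL2ε]
  have hnum : 3 * (2 * e + 2700 * (F.L : ℝ) * ε₀) ≤ 1 / 4000 := by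
    have e1 : 3 * (2 * e + 2700 * (F.L : ℝ) * ε₀) = 6 * e + 8100 * ((F.L : ℝ) * ε₀) := by ring
    rw [e1]; linarith only [heS, hLε]
  have hws : ∀ y : Site (F.P n) 0, ‖((frameTwS F n K h W (fun b => Complex.I • D b) y : (Matrix (Fin 2) (Fin 2) ℂ)ˣ) : Matrix (Fin 2) (Fin 2) ℂ) - 1‖ ≤ 1 / 400 := by
    intro y
    have h1 := (hsym ⟨y, d0⟩).2.1
    have hnum' : 30 * (F.L : ℝ) * (2 * e + 2700 * (F.L : ℝ) * ε₀) ≤ 1 / 400 := by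
      have e1 : 30 * (F.L : ℝ) * (2 * e + 2700 * (F.L : ℝ) * ε₀) = 60 * ((F.L : ℝ) * e) + 81000 * ((F.L : ℝ) ^ 2 * ε₀) := by ring
      rw [e1]; linarith only [hLe, hL2ε]
    exact h1.trans hnum'
  have hzs : ∀ c : PBond (F.P n) 0, ‖((dbarTwS F n K h W (fun b => Complex.I • D b) c : (Matrix (Fin 2) (Fin 2) ℂ)ˣ) : Matrix (Fin 2) (Fin 2) ℂ) - 1‖ ≤ 1 / 30 :=
    fun c => (hsym c).1.trans (hnum.trans (by norm_num))
  -- the symmetric frame mass (F3″-Φˢ-EXPORT) and the top twisted-link mass (px17, `l = K − n`)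
  have hΦs := sum_normSq_frameTwS_sub_one_le_of_regPr F n K h hε₀ hεL hs0 hs4 hsL hreg D hD hs
  have hfield : (fun b : PBond (F.P K) 0 => expUnit (Complex.I • D b) * bgUnits F K W b) = unitsField (toUField (emb15 W (expHermField D))) :=
    (unitsField_toUField_emb15_expHermField (F := F) (K := K) W D hD).symm
  have hZ : ∑ c : PBond (F.P n) 0, ‖((dbarTwS F n K h W (fun b => Complex.I • D b) c : (Matrix (Fin 2) (Fin 2) ℂ)ˣ) : Matrix (Fin 2) (Fin 2) ℂ) - 1‖ ^ 2
      ≤ (21 + 10080 * (F.L : ℝ) ^ 3) * ((∑ b : PBond (F.P K) 0, ‖pertVar W (emb15 W (expHermField D)) b‖ ^ 2) * ((F.L : ℝ) ^ (K - n))⁻¹)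
          + (3 + 720 * (F.L : ℝ) ^ 2) * ((28800 * (F.L : ℝ) ^ 4 * ((∑ x : Site (F.P K) 0, ∑ μ : Fin (F.P K).d, ∑ ν : Fin (F.P K).d,
            (if μ < ν then ∑ j : Fin 2, ∑ k : Fin 2,
              ‖(curl (torusT (F.P K) 0) (fun κ z => unitsField (toUField W) ⟨z, κ⟩) (fun κ z => pertVar W (emb15 W (expHermField D)) ⟨z, κ⟩) μ ν x) j k‖ ^ 2 else 0)) + (∑ x : Site (F.P K) 0, ∑ j : Fin 2, ∑ k : Fin 2,
            ‖(divB (torusT (F.P K) 0) (fun κ z => unitsField (toUField W) ⟨z, κ⟩) (fun κ z => pertVar W (emb15 W (expHermField D)) ⟨z, κ⟩) x) j k‖ ^ 2))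
            + 600000 * (F.L : ℝ) ^ 4 * (((F.L : ℝ) ^ (K - n)) ^ 2)⁻¹ * (∑ b : PBond (F.P K) 0, ‖pertVar W (emb15 W (expHermField D)) b‖ ^ 2)) * (F.L : ℝ) ^ (K - n)) := by
    have hre : ∑ c : PBond (F.P n) 0, ‖((dbarTwS F n K h W (fun b => Complex.I • D b) c : (Matrix (Fin 2) (Fin 2) ℂ)ˣ) : Matrix (Fin 2) (Fin 2) ℂ) - 1‖ ^ 2
        = ∑ b : PBond (F.P K) (K - n), ‖((dbarCovIterU (K - n) (unitsField (toUField W)) (unitsField (toUField (emb15 W (expHermField D)))) b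
            * (emlIterU (K - n) (unitsField (toUField W)) b)⁻¹ : (Matrix (Fin 2) (Fin 2) ℂ)ˣ) : Matrix (Fin 2) (Fin 2) ℂ) - 1‖ ^ 2 := by
      refine Fintype.sum_equiv (bondShift (sites_eq F n K h)) _ _ fun c => ?_
      rw [dbarTwS_eq_dbarCovIterU_mul_inv, hfield]
      rfl
    rw [hre]
    exact sum_normSq_twistedLevelRatio_le_of_regPr F n K hε₀ hεL hs0 hs4 hsL hreg D hD hs (K - n) le_rfl
  exact sum_norm_CmapTw_sub_CmapTwS_le_of_masses F h hε₀ hε10 hε12 W hreg (fun b => Complex.I • D b) hAskew hAtr hwc hws hzs hR0 hΦc hΦs hZ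

end Member

end Summit.QuantumFields.YangMills.Theorems.Prop7CombSymDiffL1OfR0FrameMasses

end
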